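import Literature.Probability.Percolation.SprinkledStep
import Literature.Probability.Percolation.AdaptiveProbing
import HarnessLib

/-!
# Growing the patched cluster: the adaptive probe of one Martineau–Tassion step

Topic: `Literature/Probability/Percolation`. The exploration algorithm of Martineau–Tassion
(*Locality of percolation for abelian Cayley graphs*, Ann. Probab. 45 (2017), §4, proof of
Lemma 4.4: "In the configuration `ω_{t+1} := ω_t ∨ ξ^{z_t}`, explore the connected component
`H_{t+1}` of the origin … Notice that only the edges of `H ∪ ΔH` have been explored") realised as
an ADAPTIVE PROBE in the sense of `AdaptiveProbing.lean`, on the layered coins of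
`SprinkledCoupling.lean` / `SprinkledStep.lean`, for the labelled renormalisation of
`LabelledRenormalization.lean`. Everything here is deterministic combinatorics of one step, for an
arbitrary vertex type; no graph is needed (all non-diagonal pairs of the finite domain count as
potential edges: pairs that are not edges of the base graph are almost surely never open).

Given the relevant layers `Rel`, a finite domain `Dom ∋ x₀`, and the record so far (`Rv` revealed
coins, `Op ⊆ Rv` the open ones):

* `clus Rel C Dom x₀` — the cluster of `x₀` inside `Dom` of the base configuration `cfgOf Rel C`
  read off a set `C` of open coins;
* `pclus … ω = clus Rel (patch Rv Op ω) Dom x₀` — the cluster seen on `ω` through the patched coins;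
* `coinsOf Rel E` — the relevant coins of a set of pairs; `meetPairs Dom K` — the non-diagonal pairs
  of `Dom` meeting `K`;
* `revealOf … ω = coinsOf Rel (meetPairs Dom (pclus ω)) \ Rv` — the coins the step examines: the
  fresh relevant coins of the pairs meeting the final cluster ("only the edges of `H ∪ ΔH`");
* `clusterProbe` — these data as an `AProbe` (envelope: all fresh relevant coins of pairs of
  `Dom`), with the LOCALITY proof `pclus_congr`: a configuration agreeing with `ω` on the examined
  coins has the same cluster (a path leaving the cluster of `ω` would cross an examined, closed
  boundary pair);
* `clus_read_eq_pclus` — the BRIDGE to recorded data: the cluster recomputed from the known-open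
  coins `Op ∪ obs ω (revealOf ω)` alone equals the patched cluster (so a success criterion stated
  on records agrees with the event `GMStep.StepData.succEvt` of `SprinkledStep.lean`);
* monotonicity of `clus` in the coins, the layers and the domain (the clusters grow along the run).

## References

* S. Martineau, V. Tassion, Ann. Probab. 45 (2017) 1247–1277, arXiv:1312.1946, §4, proof of
  Lemma 4.4 (the exploration) [MartineauTassion2017].
* G. Grimmett, *Percolation*, 2nd ed., Springer 1999, §7.2 pp. 156–157 (the edge sets `E_k` and
  their boundaries in the dynamic construction) [GrimmettPercolation1999].
-/

noncomputable section

namespace Literature.Probability.Percolation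

namespace GMStep

open ProbeHistory DCT16
open scoped Classical

variable {V₀ : Type*} {L r : ℕ}

/-! ## Clusters read off a set of open coins -/

/-- The cluster of `x₀` inside the finite domain `Dom` for the base configuration read, through the
relevant layers `Rel`, off the set `C` of open coins. [cite: MartineauTassion2017, §4 (H_{t+1})] -/
def clus (Rel : Sym2 V₀ → Finset (Fin (L + 1))) (C : BondConfig (V₀ × Layer L r)) (Dom : Finset V₀) (x₀ : V₀) :
    Finset V₀ :=
  Dom.filter fun v => PathIn (openGraph (cfgOf Rel C)) ↑Dom x₀ v

/-- Membership in `clus`. [folklore] -/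
theorem mem_clus_iff {Rel : Sym2 V₀ → Finset (Fin (L + 1))} {C : BondConfig (V₀ × Layer L r)} {Dom : Finset V₀}
    {x₀ v : V₀} : v ∈ clus Rel C Dom x₀ ↔ PathIn (openGraph (cfgOf Rel C)) ↑Dom x₀ v := by
  rw [clus, Finset.mem_filter, and_iff_right_iff_imp]
  exact fun h => Finset.mem_coe.1 h.right_mem

/-- `clus ⊆ Dom`. [folklore] -/
theorem clus_subset {Rel : Sym2 V₀ → Finset (Fin (L + 1))} {C : BondConfig (V₀ × Layer L r)} {Dom : Finset V₀}
    {x₀ : V₀} : clus Rel C Dom x₀ ⊆ Dom := Finset.filter_subset _ _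

/-- The origin lies in its cluster (if it lies in the domain). [folklore] -/
theorem self_mem_clus {Rel : Sym2 V₀ → Finset (Fin (L + 1))} {C : BondConfig (V₀ × Layer L r)} {Dom : Finset V₀}
    {x₀ : V₀} (h : x₀ ∈ Dom) : x₀ ∈ clus Rel C Dom x₀ :=
  mem_clus_iff.2 (PathIn.refl (Finset.mem_coe.2 h))

/-- **Monotonicity of clusters** in the coins, the relevant layers and the domain. [folklore] -/
theorem clus_mono {Rel Rel' : Sym2 V₀ → Finset (Fin (L + 1))} (hRel : ∀ e, Rel e ⊆ Rel' e)
    {C C' : BondConfig (V₀ × Layer L r)} (hC : C ⊆ C') {Dom Dom' : Finset V₀} (hDom : Dom ⊆ Dom') (x₀ : V₀) :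
    clus Rel C Dom x₀ ⊆ clus Rel' C' Dom' x₀ := by
  intro v hv
  rw [mem_clus_iff] at hv ⊢
  exact (hv.mono (Finset.coe_subset.2 hDom)).mono_graph
    (openGraph_mono ((cfgOf_mono_rel hRel C).trans (cfgOf_mono Rel' hC)))

/-- Every vertex on a path from `x₀` inside `Dom` lies in the cluster; so a path from `x₀` inside
`Dom` is a path inside the cluster. [folklore] -/
theorem pathIn_clus_of_pathIn {Rel : Sym2 V₀ → Finset (Fin (L + 1))} {C : BondConfig (V₀ × Layer L r)}
    {Dom : Finset V₀} {x₀ v : V₀} (h : PathIn (openGraph (cfgOf Rel C)) ↑Dom x₀ v) :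
    PathIn (openGraph (cfgOf Rel C)) (↑Dom ∩ ↑(clus Rel C Dom x₀)) x₀ v := by
  obtain ⟨hx₀, hr⟩ := h
  refine ⟨⟨hx₀, Finset.mem_coe.2 (self_mem_clus (Finset.mem_coe.1 hx₀))⟩, ?_⟩
  induction hr with
  | refl => exact Relation.ReflTransGen.refl
  | @tail b c hab hbc ih =>
    refine ih.tail ⟨hbc.1, hbc.2, Finset.mem_coe.2 (mem_clus_iff.2 ?_)⟩
    exact (show PathIn (openGraph (cfgOf Rel C)) ↑Dom x₀ b from ⟨hx₀, hab⟩).tail hbc.1 hbc.2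

/-! ## Relevant coins of pairs; the pairs meeting a set -/

/-- The relevant coins of the pairs in `E`. [folklore] -/
def coinsOf (Rel : Sym2 V₀ → Finset (Fin (L + 1))) (E : Finset (Sym2 V₀)) : Finset (Sym2 (V₀ × Layer L r)) :=
  E.biUnion fun e => (Rel e).biUnion fun l => layerCoins l e

/-- Membership in `coinsOf`. [folklore] -/
theorem mem_coinsOf_iff {Rel : Sym2 V₀ → Finset (Fin (L + 1))} {E : Finset (Sym2 V₀)} {c : Sym2 (V₀ × Layer L r)} :
    c ∈ coinsOf Rel E ↔ ∃ e ∈ E, ∃ l ∈ Rel e, c ∈ layerCoins l e := by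
  simp [coinsOf]

/-- `coinsOf` is monotone. [folklore] -/
theorem coinsOf_mono {Rel Rel' : Sym2 V₀ → Finset (Fin (L + 1))} (hRel : ∀ e, Rel e ⊆ Rel' e)
    {E E' : Finset (Sym2 V₀)} (hE : E ⊆ E') : coinsOf (r := r) Rel E ⊆ coinsOf Rel' E' := by
  intro c hc
  obtain ⟨e, he, l, hl, hcl⟩ := mem_coinsOf_iff.1 hc
  exact mem_coinsOf_iff.2 ⟨e, hE he, l, hRel e hl, hcl⟩

/-- The non-diagonal pairs of the domain meeting the set `K`. [cite: MartineauTassion2017, §4 ("the edges of H ∪ ΔH")] -/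
def meetPairs (Dom K : Finset V₀) : Finset (Sym2 V₀) :=
  Dom.sym2.filter fun e => ¬e.IsDiag ∧ ∃ v ∈ e, v ∈ K

/-- Membership in `meetPairs` for a concrete pair. [folklore] -/
theorem mk_mem_meetPairs_iff {Dom K : Finset V₀} {a b : V₀} :
    s(a, b) ∈ meetPairs Dom K ↔ a ∈ Dom ∧ b ∈ Dom ∧ a ≠ b ∧ (a ∈ K ∨ b ∈ K) := by
  simp only [meetPairs, Finset.mem_filter, Finset.mk_mem_sym2_iff, Sym2.mk_isDiag_iff, Sym2.mem_iff]
  constructor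
  · rintro ⟨⟨ha, hb⟩, hne, v, hv | hv, hvK⟩
    · exact ⟨ha, hb, hne, Or.inl (hv ▸ hvK)⟩
    · exact ⟨ha, hb, hne, Or.inr (hv ▸ hvK)⟩
  · rintro ⟨ha, hb, hne, hK | hK⟩
    · exact ⟨⟨ha, hb⟩, hne, a, Or.inl rfl, hK⟩
    · exact ⟨⟨ha, hb⟩, hne, b, Or.inr rfl, hK⟩

/-- `meetPairs` is monotone in the set. [folklore] -/
theorem meetPairs_mono {Dom K K' : Finset V₀} (h : K ⊆ K') : meetPairs Dom K ⊆ meetPairs Dom K' := by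
  intro e he
  obtain ⟨hD, hnd, v, hv, hvK⟩ := Finset.mem_filter.1 he
  exact Finset.mem_filter.2 ⟨hD, hnd, v, hv, h hvK⟩

/-- `meetPairs` is monotone in the domain. [folklore] -/
theorem meetPairs_mono_dom {Dom Dom' K : Finset V₀} (h : Dom ⊆ Dom') : meetPairs Dom K ⊆ meetPairs Dom' K := by
  intro e he
  obtain ⟨hD, hnd, v, hv, hvK⟩ := Finset.mem_filter.1 he
  exact Finset.mem_filter.2 ⟨Finset.sym2_mono h hD, hnd, v, hv, hvK⟩

/-- All non-diagonal pairs of the domain. [folklore] -/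
def domPairs (Dom : Finset V₀) : Finset (Sym2 V₀) := Dom.sym2.filter fun e => ¬e.IsDiag

/-- `meetPairs ⊆ domPairs`. [folklore] -/
theorem meetPairs_subset_domPairs (Dom K : Finset V₀) : meetPairs Dom K ⊆ domPairs Dom := by
  intro e he
  obtain ⟨hD, hnd, -⟩ := Finset.mem_filter.1 he
  exact Finset.mem_filter.2 ⟨hD, hnd⟩

/-! ## The patched cluster and the examined coins -/

section Probe

variable (Rel : Sym2 V₀ → Finset (Fin (L + 1))) (Dom : Finset V₀) (x₀ : V₀) (Rv Op : Finset (Sym2 (V₀ × Layer L r)))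

/-- The cluster of `x₀` seen on `ω` through the patched coins. [cite: MartineauTassion2017, §4 (H_{t+1})] -/
def pclus (ω : BondConfig (V₀ × Layer L r)) : Finset V₀ := clus Rel (patch Rv Op ω) Dom x₀

/-- **The examined coins**: the fresh relevant coins of the pairs of the domain meeting the patched
cluster ("only the edges of `H ∪ ΔH` have been explored", Martineau–Tassion p. 15).
[cite: MartineauTassion2017, §4 proof of Lemma 4.4] -/
def revealOf (ω : BondConfig (V₀ × Layer L r)) : Finset (Sym2 (V₀ × Layer L r)) :=
  coinsOf Rel (meetPairs Dom (pclus Rel Dom x₀ Rv Op ω)) \ Rv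

/-- The envelope: all fresh relevant coins of pairs of the domain. [folklore] -/
def envOf : Finset (Sym2 (V₀ × Layer L r)) := coinsOf Rel (domPairs Dom) \ Rv

variable {Rel Dom x₀ Rv Op}

/-- The examined coins lie in the envelope. [folklore] -/
theorem revealOf_subset_envOf (ω : BondConfig (V₀ × Layer L r)) : revealOf Rel Dom x₀ Rv Op ω ⊆ envOf Rel Dom Rv :=
  Finset.sdiff_subset_sdiff (coinsOf_mono (fun _ => subset_rfl) (meetPairs_subset_domPairs _ _)) subset_rfl

/-- The examined coins are fresh. [folklore] -/
theorem disjoint_revealOf (ω : BondConfig (V₀ × Layer L r)) : Disjoint (revealOf Rel Dom x₀ Rv Op ω) Rv :=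
  Finset.sdiff_disjoint

/-- A relevant coin of a pair meeting the patched cluster is either revealed earlier or examined now.
[folklore] -/
theorem mem_Rv_or_mem_revealOf {ω : BondConfig (V₀ × Layer L r)} {a b : V₀} (hab : s(a, b) ∈ meetPairs Dom (pclus Rel Dom x₀ Rv Op ω))
    {l : Fin (L + 1)} (hl : l ∈ Rel s(a, b)) {c : Sym2 (V₀ × Layer L r)} (hc : c ∈ layerCoins l s(a, b)) :
    c ∈ Rv ∨ c ∈ revealOf Rel Dom x₀ Rv Op ω := by
  by_cases hcR : c ∈ Rv
  · exact Or.inl hcR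
  · exact Or.inr (Finset.mem_sdiff.2 ⟨mem_coinsOf_iff.2 ⟨_, hab, l, hl, hc⟩, hcR⟩)

/-- An open step of the patched configuration out of the patched cluster, inside the domain, stays in
the cluster. [folklore] -/
theorem mem_pclus_of_adj {ω : BondConfig (V₀ × Layer L r)} {a b : V₀} (ha : a ∈ pclus Rel Dom x₀ Rv Op ω)
    (hb : b ∈ Dom) (hab : (openGraph (cfgOf Rel (patch Rv Op ω))).Adj a b) : b ∈ pclus Rel Dom x₀ Rv Op ω :=
  mem_clus_iff.2 ((mem_clus_iff.1 ha).tail hab (Finset.mem_coe.2 hb))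

/-- **Transfer of open pairs meeting the cluster**: if `ω'` agrees with `ω` on the examined coins of
`ω`, then a pair meeting the patched cluster of `ω` is open after patching in `ω'` iff in `ω`
(`Op ⊆ Rv`). [folklore] -/
theorem adj_patch_iff_of_agree (hOp : Op ⊆ Rv) {ω ω' : BondConfig (V₀ × Layer L r)}
    (hag : ∀ c ∈ revealOf Rel Dom x₀ Rv Op ω, (c ∈ ω ↔ c ∈ ω')) {a b : V₀}
    (hab : s(a, b) ∈ meetPairs Dom (pclus Rel Dom x₀ Rv Op ω)) :
    (openGraph (cfgOf Rel (patch Rv Op ω))).Adj a b ↔ (openGraph (cfgOf Rel (patch Rv Op ω'))).Adj a b := by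
  rw [openGraph_adj, openGraph_adj]
  refine and_congr_left fun _ => ?_
  refine exists_congr fun l => and_congr_right fun hl => forall₂_congr fun c hc => ?_
  rcases mem_Rv_or_mem_revealOf hab hl hc with hcR | hcR
  · -- revealed earlier: frozen by the patch in both
    simp only [patch, Set.mem_union, Set.mem_sdiff, Finset.mem_coe, hcR, not_true_eq_false, and_false, false_or]
  · have hcR' : c ∉ Rv := (Finset.mem_sdiff.1 hcR).2
    rw [mem_patch_iff_of_notMem hOp hcR', mem_patch_iff_of_notMem hOp hcR', hag c hcR]

/-- **Locality of the patched cluster**: a configuration agreeing with `ω` on the examined coins of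
`ω` has the same patched cluster (`Op ⊆ Rv`, `x₀ ∈ Dom`). [cite: MartineauTassion2017, §4 proof of Lemma 4.4] -/
theorem pclus_congr (hOp : Op ⊆ Rv) (hx₀ : x₀ ∈ Dom) {ω ω' : BondConfig (V₀ × Layer L r)}
    (hag : ∀ c ∈ revealOf Rel Dom x₀ Rv Op ω, (c ∈ ω ↔ c ∈ ω')) :
    pclus Rel Dom x₀ Rv Op ω' = pclus Rel Dom x₀ Rv Op ω := by
  set K := pclus Rel Dom x₀ Rv Op ω with hK
  -- `K ⊆ K'`: paths inside `K` transfer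
  have h1 : K ⊆ pclus Rel Dom x₀ Rv Op ω' := by
    intro v hv
    have hp := pathIn_clus_of_pathIn (mem_clus_iff.1 hv)
    rw [pclus, mem_clus_iff]
    refine (pathIn_congrGraph (fun a b ha hb hab => ?_) hp).mono Set.inter_subset_left
    have hmeet : s(a, b) ∈ meetPairs Dom K :=
      mk_mem_meetPairs_iff.2 ⟨Finset.mem_coe.1 ha.1, Finset.mem_coe.1 hb.1, hab.ne, Or.inl (Finset.mem_coe.1 ha.2)⟩
    exact (adj_patch_iff_of_agree hOp hag hmeet).1 hab
  -- `K' ⊆ K`: a path leaving `K` crosses a pair meeting `K`, open in `ω'` hence in `ω`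
  refine Finset.Subset.antisymm (fun v hv => ?_) h1
  by_contra hvK
  have hp : PathIn (openGraph (cfgOf Rel (patch Rv Op ω'))) ↑Dom x₀ v := mem_clus_iff.1 hv
  obtain ⟨a, b, ha, haD, hb, hab, htail⟩ := hp.last_exit (C := (↑K : Set V₀))
    (Finset.mem_coe.2 (self_mem_clus hx₀)) (fun h => hvK (Finset.mem_coe.1 h))
  have hbD : b ∈ Dom := Finset.mem_coe.1 htail.left_mem.1
  have hmeet : s(a, b) ∈ meetPairs Dom K :=
    mk_mem_meetPairs_iff.2 ⟨Finset.mem_coe.1 haD, hbD, hab.ne, Or.inl (Finset.mem_coe.1 ha)⟩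
  have hab' : (openGraph (cfgOf Rel (patch Rv Op ω))).Adj a b := (adj_patch_iff_of_agree hOp hag hmeet).2 hab
  exact hb (Finset.mem_coe.2 (mem_pclus_of_adj (Finset.mem_coe.1 ha) hbD hab'))

/-- Hence the examined set is local: `revealOf ω' = revealOf ω` whenever `ω'` agrees with `ω` on
`revealOf ω`. [folklore] -/
theorem revealOf_congr (hOp : Op ⊆ Rv) (hx₀ : x₀ ∈ Dom) {ω ω' : BondConfig (V₀ × Layer L r)}
    (hag : ∀ c ∈ revealOf Rel Dom x₀ Rv Op ω, (c ∈ ω ↔ c ∈ ω')) :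
    revealOf Rel Dom x₀ Rv Op ω' = revealOf Rel Dom x₀ Rv Op ω := by
  rw [revealOf, revealOf, pclus_congr hOp hx₀ hag]

variable (Rel Dom x₀ Rv Op) in
/-- **The adaptive probe of a step**: examine the fresh relevant coins of the pairs meeting the
patched cluster (Martineau–Tassion's exploration of `H_{t+1}`), inside the envelope of all fresh
relevant coins of the domain. [cite: MartineauTassion2017, §4 proof of Lemma 4.4] -/
def clusterProbe (hOp : Op ⊆ Rv) (hx₀ : x₀ ∈ Dom) : AProbe (V₀ × Layer L r) :=
  ⟨envOf Rel Dom Rv, revealOf Rel Dom x₀ Rv Op, revealOf_subset_envOf, fun _ _ hag => revealOf_congr hOp hx₀ hag⟩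

/-- The probe examines `revealOf`. [folklore] -/
@[simp] theorem reveal_clusterProbe (hOp : Op ⊆ Rv) (hx₀ : x₀ ∈ Dom) (ω : BondConfig (V₀ × Layer L r)) :
    (clusterProbe Rel Dom x₀ Rv Op hOp hx₀).reveal ω = revealOf Rel Dom x₀ Rv Op ω := rfl

/-- The probe's envelope is `envOf`. [folklore] -/
@[simp] theorem env_clusterProbe (hOp : Op ⊆ Rv) (hx₀ : x₀ ∈ Dom) :
    (clusterProbe Rel Dom x₀ Rv Op hOp hx₀).env = envOf Rel Dom Rv := rfl

/-! ## The bridge: the cluster recomputed from the record -/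

/-- **Bridge**: the cluster computed from the KNOWN-open coins alone — the earlier ones `Op` and
the open examined ones `obs ω (revealOf ω)` — is the patched cluster (`Op ⊆ Rv`). Thus a success
criterion phrased on the record ("the recomputed cluster reaches `B`") is the event that the
patched cluster reaches `B`. [cite: MartineauTassion2017, §4 proof of Lemma 4.4] -/
theorem clus_read_eq_pclus (hOp : Op ⊆ Rv) (ω : BondConfig (V₀ × Layer L r)) :
    clus Rel ((↑Op : BondConfig (V₀ × Layer L r)) ∪ ↑(obs ω (revealOf Rel Dom x₀ Rv Op ω))) Dom x₀ =
      pclus Rel Dom x₀ Rv Op ω := by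
  set K := pclus Rel Dom x₀ Rv Op ω with hK
  set C : BondConfig (V₀ × Layer L r) := (↑Op : BondConfig (V₀ × Layer L r)) ∪ ↑(obs ω (revealOf Rel Dom x₀ Rv Op ω)) with hC
  -- `C ⊆ patch`
  have hCsub : C ⊆ patch Rv Op ω := by
    rintro c (hc | hc)
    · exact subset_patch Rv Op ω hc
    · rw [Finset.mem_coe, mem_obs_iff] at hc
      exact (mem_patch_iff_of_notMem hOp (Finset.mem_sdiff.1 hc.1).2).2 hc.2
  refine Finset.Subset.antisymm (clus_mono (fun _ => subset_rfl) hCsub subset_rfl x₀) fun v hv => ?_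
  -- a path inside `K`, open after patching, is open for `C`
  have hp := pathIn_clus_of_pathIn (mem_clus_iff.1 hv)
  rw [mem_clus_iff]
  refine (pathIn_congrGraph (fun a b ha hb hab => ?_) hp).mono Set.inter_subset_left
  have hmeet : s(a, b) ∈ meetPairs Dom K :=
    mk_mem_meetPairs_iff.2 ⟨Finset.mem_coe.1 ha.1, Finset.mem_coe.1 hb.1, hab.ne, Or.inl (Finset.mem_coe.1 ha.2)⟩
  rw [openGraph_adj] at hab ⊢
  refine ⟨?_, hab.2⟩
  obtain ⟨l, hl, hopen⟩ := hab.1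
  refine ⟨l, hl, fun c hc => ?_⟩
  have hcp := hopen c hc
  rcases mem_Rv_or_mem_revealOf hmeet hl hc with hcR | hcR
  · -- revealed earlier: open after patching means recorded open
    have : c ∈ (↑Op : Set _) := by
      simp only [patch, Set.mem_union, Set.mem_sdiff, Finset.mem_coe, hcR, not_true_eq_false, and_false, false_or] at hcp
      exact hcp
    exact Or.inl this
  · have hcω : c ∈ ω := (mem_patch_iff_of_notMem hOp (Finset.mem_sdiff.1 hcR).2).1 hcp
    exact Or.inr (Finset.mem_coe.2 (mem_obs_iff.2 ⟨hcR, hcω⟩))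

/-- On a configuration consistent with the record (`Rv`-coins open iff in `Op`), the patched cluster is
the true cluster read through the relevant layers. [folklore] -/
theorem pclus_eq_clus_of_consistent (hOp : Op ⊆ Rv) {ω : BondConfig (V₀ × Layer L r)}
    (h : ∀ c ∈ Rv, c ∈ ω ↔ c ∈ Op) : pclus Rel Dom x₀ Rv Op ω = clus Rel ω Dom x₀ := by
  rw [pclus, patch_eq_self hOp h]

/-- The examined coins are relevant coins of pairs of the domain meeting the patched cluster. [folklore] -/
theorem mem_revealOf_iff {ω : BondConfig (V₀ × Layer L r)} {c : Sym2 (V₀ × Layer L r)} :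
    c ∈ revealOf Rel Dom x₀ Rv Op ω ↔
      (∃ e ∈ meetPairs Dom (pclus Rel Dom x₀ Rv Op ω), ∃ l ∈ Rel e, c ∈ layerCoins l e) ∧ c ∉ Rv := by
  rw [revealOf, Finset.mem_sdiff, mem_coinsOf_iff]

end Probe

end GMStep

end Literature.Probability.Percolation
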